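import Mathlib
import Literature.AlgebraicGeometry.Resolution.ResolutionOfSingularities
import Literature.AlgebraicGeometry.Resolution.BlowupRegularPoints
import Literature.AlgebraicGeometry.Resolution.AlterationsProofs
import HarnessLib

/-!
# Regular points of opens of Γ-schemes are locally resolvable (crux `UniversalCells.MatroidCellRes`, line `birth`)

Stub `stub_regularPointLocalRes` of the skeleton `Cruxes/MatroidCellRes/Lines/birth.lean` for crux
stmt-ResolutionOfSingularities-15230 (`Summit.ResolutionOfSingularities.ResolutionOfSingularities.Theses.UniversalCells.MatroidCellRes`).
The Γ-scheme `Z_{Γ₀} = Spec (𝔽_p[a_ij : 3 × m] ⧸ (3 × 3 minors of [I₃ | A] indexed by Γ₀))` is written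
out over Mathlib exactly as in the registered signature (the two `let`s of the crux, substituted).

Proof idea: `W` is locally of finite type over the perfect field `𝔽_p` (an open immersion
followed by `Spec` of a finitely generated `𝔽_p`-algebra), so its regular locus `Reg W` is open
(`isOpen_regularLocus_of_locallyOfFiniteType_perfectField`, Matsumura, Cor. to Thm. 30.5); the
open subscheme `W' := Reg W ∋ w` has the same stalks as `W` (the stalk maps of the open immersion
`W'.ι` are isomorphisms, `IsRegularLocalRing.of_ringEquiv`), hence is regular, and a regular scheme
is its own resolution (`Scheme.IsRegular.hasResolution`).
-/

noncomputable section

-- single-problem summit: the doubled namespace component `ResolutionOfSingularities` is forced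
set_option linter.dupNamespace false

open CategoryTheory AlgebraicGeometry TopologicalSpace Literature.AlgebraicGeometry.Resolution

namespace Summit.ResolutionOfSingularities.ResolutionOfSingularities.Theorems.MatroidCellRes

/-- **Regular points of opens of Γ-schemes are locally resolvable**: if `j : W → Z_{Γ₀}` is an
open immersion into the Γ-scheme
`Z_{Γ₀} = Spec (𝔽_p[a_ij : 3 × m] ⧸ (3 × 3 minors of [I₃ | A] indexed by Γ₀))` and the
local ring `𝒪_{W, w}` is regular, then `w` has an open neighbourhood `W'` admitting a resolution of
singularities — namely `W' = Reg W`, which is open because `W` is locally of finite type over the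
perfect field `𝔽_p` (Matsumura, Cor. to Thm. 30.5), is regular (stalks of an open subscheme are
those of the ambient scheme), and so is resolved by its identity. [folklore] -/
theorem stub_regularPointLocalRes (p : ℕ) (hp : p.Prime) (m : ℕ)
    (Γ0 : Set (Fin 3 → Fin 3 ⊕ Fin m)) (W : Scheme.{0})
    (j : W ⟶ Spec (.of (
        MvPolynomial (Fin 3 × Fin m) (ZMod p) ⧸ Ideal.span ((fun u : Fin 3 → Fin 3 ⊕ Fin m => ((Matrix.fromCols (1 : Matrix (Fin 3) (Fin 3) (MvPolynomial (Fin 3 × Fin m) (ZMod p))) (Matrix.of fun i j => MvPolynomial.X (i, j))).submatrix id u).det) '' Γ0))))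
    (hj : IsOpenImmersion j) (w : W) (hw : IsRegularLocalRing (W.presheaf.stalk w)) :
    ∃ W' : W.Opens, w ∈ W' ∧ Scheme.HasResolution (W' : Scheme.{0}) := by
  haveI : Fact p.Prime := ⟨hp⟩
  haveI := hj
  -- the structure morphism `W → Z_{Γ₀} → Spec 𝔽_p` is locally of finite type
  set Q := MvPolynomial (Fin 3 × Fin m) (ZMod p) ⧸
    Ideal.span ((fun u : Fin 3 → Fin 3 ⊕ Fin m =>
      ((Matrix.fromCols (1 : Matrix (Fin 3) (Fin 3) (MvPolynomial (Fin 3 × Fin m) (ZMod p)))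
        (Matrix.of fun i j => MvPolynomial.X (i, j))).submatrix id u).det) '' Γ0)
  let g : Spec (.of Q) ⟶ Spec (.of (ZMod p)) :=
    Spec.map (CommRingCat.ofHom (algebraMap (ZMod p) Q))
  haveI hg : LocallyOfFiniteType g := by
    change LocallyOfFiniteType (Spec.map (CommRingCat.ofHom (algebraMap (ZMod p) Q)))
    rw [HasRingHomProperty.Spec_iff (P := @LocallyOfFiniteType)]
    exact RingHom.finiteType_algebraMap.mpr inferInstance
  haveI : LocallyOfFiniteType (j ≫ g) := inferInstance
  -- hence the regular locus of `W` is open; it is a regular open subscheme containing `w`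
  have hopen : IsOpen (Scheme.regularLocus W) :=
    isOpen_regularLocus_of_locallyOfFiniteType_perfectField (j ≫ g)
  let W' : W.Opens := ⟨Scheme.regularLocus W, hopen⟩
  refine ⟨W', hw, Scheme.IsRegular.hasResolution fun x => ?_⟩
  haveI : IsRegularLocalRing (W.presheaf.stalk (W'.ι x)) := x.2
  exact IsRegularLocalRing.of_ringEquiv (asIso (W'.ι.stalkMap x)).commRingCatIsoToRingEquiv

end Summit.ResolutionOfSingularities.ResolutionOfSingularities.Theorems.MatroidCellRes

end
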